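import Literature.Analysis.Complex.HutchinsonMultiplier
import Literature.Analysis.Complex.HutchinsonMultiplierLaguerre
import Literature.Analysis.Complex.HutchinsonMultiplierLimit
import HarnessLib

/-!
# Proof of `PolyaLaguerre_gaussian_CZDS` (the Gaussian sequence is a CZDS)

Topic `Literature/Analysis/Complex`. Discharges the named fact
`Literature.Analysis.Complex.PolyaLaguerre_gaussian_CZDS` of `HutchinsonMultiplier.lean`
(the sibling `HutchinsonMultiplierProofs.lean` discharges `Hutchinson1923_thmB`):
for `a ≥ 1` and every real polynomial `P = Σ b_k X^k`,
`Z_c(Σ a^{-k²} b_k X^k) ≤ Z_c(P)` (`Z_c` = number of non-real zeros with multiplicity), i.e.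
`(a^{-k²})_{k ≥ 0} ∈ CZDS` — G. Pólya's form of Laguerre's theorem, as quoted in
T. H. Nguyen, A. Vishnyakova, arXiv:1903.09070 = JMAA 480 (2019) 123433, p. 3, Thm. C and the
display following it.

## The proof formalised (Laguerre 1882 / Pólya 1929 / Craven–Csordas 1995)

1. *Laguerre's lemma* (`HutchinsonMultiplierLaguerre.lean`): for `β > 0` the operator
   `f ↦ x f' + β f = Σ (k + β) b_k x^k` keeps the degree and does not decrease the number of real
   zeros counted with multiplicity (Rolle for `|x|^β f(x)` on the gaps of `{0} ∪ {real zeros}`,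
   plus multiplicity bookkeeping); iterate it `N` times: multiplier `(k + β)^N`.
2. Rescale `x ↦ e^{-Ns} x` and multiply by `s^N` (`β = 1/s`): multiplier
   `w_N(k) = (1 + k s)^N e^{-N k s}`, still with at least as many real zeros as `P` and the same
   degree.
3. *Limit* (`HutchinsonMultiplierLimit.lean`): with `s_m = √(2 log a)/(m+1)`, `N_m = (m+1)²`,
   `w_{N_m}(k) → e^{-k² log a} = a^{-k²}` (second-order expansion of `log (1+u)`), and the number
   of real zeros with multiplicity is upper semicontinuous under coefficientwise convergence at
   fixed degree; the degree of the Gaussian twist equals `deg P`, so `Z_c` does not increase.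

Deviation from the printed route: Pólya proves Thm. C for all `φ ∈ L-P` with negative zeros via
uniform approximation by polynomials with negative zeros; here only the polynomial multipliers
`φ_N(x) = (1 + s x)^N` (single zero `-1/s < 0`) are needed, which realise the Gaussian in the
limit `N s² → 2 log a`.

## References

* G. Pólya, *Über einen Satz von Laguerre*, Jber. Deutsch. Math.-Verein. 38 (1929) 161–168.
* T. Craven, G. Csordas, *Complex zero decreasing sequences*, Methods Appl. Anal. 2 (1995)
  420–441.
* T. H. Nguyen, A. Vishnyakova, JMAA 480 (2019) 123433 = arXiv:1903.09070, p. 3 Thm. C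
  [NguyenVishnyakova2019].
-/

noncomputable section

namespace Literature.Analysis.Complex

open Polynomial Filter
open _root_.Topology

/-- Coefficients of the Gaussian twist: `(gaussTwist a P)_k = a^{-k²} P_k` for every `k`.
[cite: NguyenVishnyakova2019, p. 3, display following Thm. C ((a^{-k²}) ∈ CZDS)] -/
theorem coeff_gaussTwist (a : ℝ) (P : ℝ[X]) (k : ℕ) :
    (gaussTwist a P).coeff k = (a ^ (k ^ 2))⁻¹ * P.coeff k := by
  simp only [gaussTwist, finsetSum_coeff, coeff_C_mul_X_pow]
  by_cases h : k < P.natDegree + 1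
  · rw [Finset.sum_eq_single k, if_pos rfl]
    · intro b _ hb
      rw [if_neg (Ne.symm hb)]
    · intro hk
      exact absurd (Finset.mem_range.2 h) hk
  · rw [Finset.sum_eq_zero, coeff_eq_zero_of_natDegree_lt (by omega), mul_zero]
    intro x hx
    rw [if_neg]
    rintro rfl
    exact h (Finset.mem_range.1 hx)

/-- The Gaussian twist of a nonzero polynomial is nonzero (`a ≠ 0`). [folklore] -/
theorem gaussTwist_ne_zero {a : ℝ} (ha : a ≠ 0) {P : ℝ[X]} (hP : P ≠ 0) :
    gaussTwist a P ≠ 0 := by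
  intro h
  have h1 := congrArg (fun p : ℝ[X] => p.coeff P.natDegree) h
  simp only [coeff_gaussTwist, coeff_zero] at h1
  exact mul_ne_zero (inv_ne_zero (pow_ne_zero _ ha)) (leadingCoeff_ne_zero.2 hP) h1

/-- The Gaussian twist preserves the degree (`a ≠ 0`). [folklore] -/
theorem natDegree_gaussTwist {a : ℝ} (ha : a ≠ 0) (P : ℝ[X]) :
    (gaussTwist a P).natDegree = P.natDegree := by
  rcases eq_or_ne P 0 with rfl | hP
  · have h0 : gaussTwist a 0 = 0 := by
      ext k
      rw [coeff_gaussTwist]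
      simp
    rw [h0]
  refine le_antisymm ?_ ?_
  · refine (natDegree_le_iff_coeff_eq_zero).2 fun k hk => ?_
    rw [coeff_gaussTwist, coeff_eq_zero_of_natDegree_lt hk, mul_zero]
  · refine le_natDegree_of_ne_zero ?_
    rw [coeff_gaussTwist]
    exact mul_ne_zero (inv_ne_zero (pow_ne_zero _ ha)) (leadingCoeff_ne_zero.2 hP)

/-- **Laguerre–Pólya for the Gaussian multiplier, root-count form.** For `a > 1` the twist
`Σ a^{-k²} b_k X^k` has at least as many real roots (with multiplicity) as `P = Σ b_k X^k`.
Proof (Pólya 1929; Craven–Csordas 1995): with `c = log a`, `s_m = √(2c)/(m+1)`,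
`M_m = (m+1)²`, the polynomial `G_m = s_m^{M_m} · ((θ + s_m⁻¹)^{M_m} P)(e^{-M_m s_m} x)` has
coefficients `(1 + k s_m)^{M_m} e^{-M_m k s_m} b_k → e^{-ck²} b_k`, the same degree as `P`, and
(Laguerre's lemma, iterated) at least as many real roots as `P`; the real-root count is upper
semicontinuous in the limit. [cite: NguyenVishnyakova2019, p. 3 Thm. C and following display] -/
theorem card_roots_le_gaussTwist {a : ℝ} (ha : 1 < a) (P : ℝ[X]) :
    Multiset.card P.roots ≤ Multiset.card (gaussTwist a P).roots := by
  rcases eq_or_ne P 0 with rfl | hP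
  · simp
  set c : ℝ := Real.log a with hc
  have hcpos : 0 < c := Real.log_pos ha
  have ha0 : 0 < a := by linarith
  set σ : ℝ := Real.sqrt (2 * c) with hσ
  have hσpos : 0 < σ := Real.sqrt_pos.2 (by positivity)
  have hσ2 : σ ^ 2 = 2 * c := Real.sq_sqrt (by positivity)
  set n := P.natDegree with hn
  -- parameters of the approximating Laguerre multipliers
  set s : ℕ → ℝ := fun m => σ / ((m : ℝ) + 1) with hs
  set M : ℕ → ℕ := fun m => (m + 1) ^ 2 with hM
  have hspos : ∀ m, 0 < s m := fun m => div_pos hσpos (by positivity)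
  have hMs : ∀ m, (M m : ℝ) * s m ^ 2 = 2 * c := by
    intro m
    simp only [hM, hs]
    push_cast
    rw [div_pow, ← hσ2]
    field_simp
  have hs0 : Tendsto s atTop (𝓝 0) := by
    have h1 : Tendsto (fun m : ℕ => (m : ℝ) + 1) atTop atTop :=
      tendsto_atTop_add_const_right _ 1 tendsto_natCast_atTop_atTop
    exact tendsto_const_nhds.div_atTop h1
  -- the approximants `G m`
  set Q : ℕ → ℝ[X] := fun m =>
    (fun p : ℝ[X] => X * derivative p + C (s m)⁻¹ * p)^[M m] P with hQ
  set G : ℕ → ℝ[X] := fun m =>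
    C (s m ^ M m) * (Q m).comp (C (Real.exp (-((M m : ℝ) * s m))) * X) with hG
  have hGcoeff : ∀ m k, (G m).coeff k
      = ((1 + k * s m) ^ (M m) * Real.exp (-(M m * (k * s m)))) * P.coeff k := by
    intro m k
    simp only [hG, hQ]
    rw [LaguerreCZDS.coeff_scale, LaguerreCZDS.coeff_iterate, ← Real.exp_nat_mul]
    have hsm : s m ≠ 0 := (hspos m).ne'
    have h1 : s m ^ M m * ((k : ℝ) + (s m)⁻¹) ^ M m = (1 + k * s m) ^ M m := by
      rw [← mul_pow]
      congr 1
      field_simp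
      ring
    have h2 : (k : ℝ) * -((M m : ℝ) * s m) = -((M m : ℝ) * (k * s m)) := by ring
    rw [h2]
    calc s m ^ M m * Real.exp (-((M m : ℝ) * (k * s m))) * (((k : ℝ) + (s m)⁻¹) ^ M m * P.coeff k)
        = (s m ^ M m * ((k : ℝ) + (s m)⁻¹) ^ M m) * Real.exp (-((M m : ℝ) * (k * s m)))
            * P.coeff k := by ring
      _ = (1 + k * s m) ^ M m * Real.exp (-((M m : ℝ) * (k * s m))) * P.coeff k := by rw [h1]
  have hGdeg : ∀ m, (G m).natDegree ≤ n := by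
    intro m
    simp only [hG, hQ]
    rw [LaguerreCZDS.natDegree_scale _ (pow_ne_zero _ (hspos m).ne') (Real.exp_pos _).ne',
      LaguerreCZDS.natDegree_iterate _ (inv_pos.2 (hspos m))]
  have hGcard : ∀ m, Multiset.card P.roots ≤ Multiset.card (G m).roots := by
    intro m
    simp only [hG, hQ]
    rw [LaguerreCZDS.card_roots_scale _ (pow_ne_zero _ (hspos m).ne') (Real.exp_pos _).ne']
    exact LaguerreCZDS.card_roots_le_iterate _ (inv_pos.2 (hspos m)) _
  -- pass to the limit `G m → gaussTwist a P`
  refine LaguerreCZDS.le_card_roots_of_tendsto (Multiset.card P.roots) n (gaussTwist a P) G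
    (gaussTwist_ne_zero ha0.ne' hP) (natDegree_gaussTwist ha0.ne' P) hGdeg ?_ hGcard
  intro k
  simp_rw [hGcoeff]
  rw [coeff_gaussTwist]
  have hak : (a ^ (k ^ 2))⁻¹ = Real.exp (-(c * (k : ℝ) ^ 2)) := by
    rw [← inv_exp_pow_sq c k, hc, Real.exp_log ha0]
  rw [hak]
  exact (LaguerreCZDS.tendsto_weights k hspos hMs hs0).mul_const _

/-- **Discharge of `PolyaLaguerre_gaussian_CZDS`: the Gaussian sequence `(a^{-k²})_{k≥0}`,
`a ≥ 1`, is a complex zero decreasing sequence** — for every real polynomial `P`,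
`Z_c(Σ a^{-k²} b_k z^k) ≤ Z_c(P)` (Laguerre; Pólya 1929, as quoted in Nguyen–Vishnyakova 2019,
Thm. C and the display following it). Proof: `card_roots_le_gaussTwist` (Laguerre's lemma for
`θ + β`, iterated, plus the coefficientwise limit `(1+ks)^N e^{-Nks} → e^{-ck²}` and upper
semicontinuity of the real-root count) and `deg (gaussTwist a P) = deg P`; `a = 1` is the
identity. [cite: NguyenVishnyakova2019, p. 3 Thm. C and following display] -/
theorem PolyaLaguerre_gaussian_CZDS_holds : PolyaLaguerre_gaussian_CZDS := by
  intro a ha P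
  unfold nonrealRootCount
  have ha0 : a ≠ 0 := by positivity
  rw [natDegree_gaussTwist ha0]
  rcases ha.eq_or_lt with h | h
  · subst h
    have h1 : gaussTwist 1 P = P := by
      ext k
      rw [coeff_gaussTwist]
      simp
    rw [h1]
  · exact Nat.sub_le_sub_left (card_roots_le_gaussTwist h P) _

end Literature.Analysis.Complex

end
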